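import Mathlib
import Summits.NavierStokesRegularity.NavierStokesRegularity.Theses.LevelSetModeration
import Summits.NavierStokesRegularity.NavierStokesRegularity.Theorems.HighSpeedPressureWork.Negative.ExponentCollapse
import Summits.NavierStokesRegularity.NavierStokesRegularity.Theorems.LevelSetModerationLevelSetClosure
import Summits.NavierStokesRegularity.NavierStokesRegularity.Theorems.LevelSetModerationHighSpeedPressureWorkLinearLawOfCrux
import Summits.NavierStokesRegularity.NavierStokesRegularity.Theorems.LevelSetModerationHighSpeedPressureWorkLinearClosureTransfer

/-!
# Route LevelSetModeration — the logical structure of crux `HighSpeedPressureWork`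

Item stmt-NavierStokesRegularity-18149, line `linear_closure`. With the landed one-way theorems
`levelSetModeration_linearLevelSetLaw_of_highSpeedPressureWork` (crux → L1),
`levelSetModeration_highSpeedPressureWork_of_linearLaw_of_bookkeeping` (L1 ∧ L3 → crux) and
`levelSetModeration_aprioriSpeedBound_of_linearLevelSetLaw` (L1 → a priori speed bound), this file
closes the square:

* `levelSetModeration_boundedPairingBookkeeping_of_highSpeedPressureWork` — the crux implies the
  registered stub `stub_boundedPairingBookkeeping` (L3) verbatim: on a fibre `(ν, T)` carrying a
  class-uniform speed bound `G(E₀,B₀)`, the factor `M^m` of the crux is absorbed into the data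
  modulus (`m ≥ 0`: the disprover's exponent collapse — above `2G⁺+1` the level sets are empty;
  `m < 0`: `M^m ≤ (2B₀)^m` on the windows `M ≥ 2B₀ > 0`; `B₀ ≤ 0`: the datum vanishes, the
  Leray–Hopf energy inequality and continuity force `u ≡ 0` on `[0,T)`, and the pressure work is `0`).
* `levelSetModeration_highSpeedPressureWork_iff_linearLaw_and_bookkeeping` —
  `HighSpeedPressureWork ↔ L1 ∧ L3`: the crux IS the linear level-set law plus the bounded
  bookkeeping, as kernel-checked statements (both stubs verbatim).
* `levelSetModeration_aprioriSpeedBound_of_highSpeedPressureWork` — the crux implies, on every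
  fibre `(ν, T)`, a class-uniform a priori speed bound `APrioriSpeedBound ν T G` of the data class
  `(E₀, B₀)`: uniform quantitative regularity (why the item is open-problem class).
-/

noncomputable section

-- single-conjunct summit: `Summit.<Summit>.<Problem>` repeats the name by the D-0017 layout
set_option linter.dupNamespace false

namespace Summit.NavierStokesRegularity.NavierStokesRegularity.Theorems

open MeasureTheory Set Filter Topology
open scoped ENNReal
open Literature.Analysis.FluidPDE
open Summit.NavierStokesRegularity.NavierStokesRegularity.Theses.LevelSetModeration
open Summit.NavierStokesRegularity.NavierStokesRegularity.Theorems.HighSpeedPressureWork.Negative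

/-- Rest-state degeneracy: a classical Leray–Hopf solution on `[0,T)` whose datum vanishes
pointwise vanishes identically on `[0,T)` (energy inequality `∫|u(τ)|² ≤ ∫|u₀|² = 0`, continuity of
the slice `u τ`, and `volume` charges open sets). -/
theorem levelSetModeration_eq_zero_of_datum_eq_zero {ν T : ℝ} (hν : 0 < ν)
    {u : ℝ → EuclideanSpace ℝ (Fin 3) → EuclideanSpace ℝ (Fin 3)}
    {p : ℝ → EuclideanSpace ℝ (Fin 3) → ℝ}
    (hcl : IsClassicalNSSolutionOn (Set.Ico 0 T) ν 0 u p) (hLH : IsLerayHopfOn T ν 0 (u 0) u)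
    (h0 : ∀ x, u 0 x = 0) {τ : ℝ} (hτ : τ ∈ Set.Ico 0 T) : ∀ x, u τ x = 0 := by
  have hτ' : τ ∈ Icc 0 T := ⟨hτ.1, hτ.2.le⟩
  obtain ⟨hint, hle⟩ := integral_norm_sq_le_of_lerayHopf hLH hν.le hτ'
  have hzero : (∫ x, ‖u 0 x‖ ^ 2) = 0 := by
    simp [h0]
  have hnonneg : 0 ≤ᵐ[volume] fun x => ‖u τ x‖ ^ 2 := ae_of_all _ fun x => sq_nonneg _
  have hint0 : (∫ x, ‖u τ x‖ ^ 2) = 0 :=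
    le_antisymm (hle.trans hzero.le) (integral_nonneg fun x => sq_nonneg _)
  have hae : (fun x => ‖u τ x‖ ^ 2) =ᵐ[volume] 0 :=
    (integral_eq_zero_iff_of_nonneg_ae hnonneg hint).1 hint0
  have hcont : Continuous fun x => ‖u τ x‖ ^ 2 :=
    ((hcl.contDiff_velocity hτ).continuous.norm).pow 2
  have heq : (fun x => ‖u τ x‖ ^ 2) = 0 :=
    (Continuous.ae_eq_iff_eq volume hcont continuous_const).1 hae
  intro x
  have hx := congrFun heq x
  simp only [Pi.zero_apply, ne_eq, OfNat.ofNat_ne_zero, not_false_eq_true, pow_eq_zero_iff,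
    norm_eq_zero] at hx
  exact hx

/-- **The crux implies the bounded bookkeeping** (stub L3 of line `linear_closure`, verbatim):
under a class-uniform speed bound `G(E₀,B₀)` on the fibre `(ν,T)`, the crux's factor `M^m` is
absorbed into the data modulus — `F'(E₀,B₀) := F⁺(E₀,B₀) · max((2G⁺+1)^m, (2B₀)^m)⁺`: for
`M ≤ 2G⁺+1` and `m ≥ 0` use `M^m ≤ (2G⁺+1)^m`, for `m < 0` use `M^m ≤ (2B₀)^m` (`M ≥ 2B₀ > 0`);
for `M > 2G⁺+1` the level `c ≥ M/2 > G` is never reached and the pressure work vanishes; for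
`B₀ ≤ 0` the solution is the rest state (`levelSetModeration_eq_zero_of_datum_eq_zero`). -/
theorem levelSetModeration_boundedPairingBookkeeping_of_highSpeedPressureWork :
    Summit.NavierStokesRegularity.NavierStokesRegularity.Theses.LevelSetModeration.HighSpeedPressureWork
      → (∀ (ν T : ℝ), 0 < ν → 0 < T → ∀ G : ℝ → ℝ → ℝ, (∀ (u : ℝ → EuclideanSpace ℝ (Fin 3) →
      EuclideanSpace ℝ (Fin 3)) (p : ℝ → EuclideanSpace ℝ (Fin 3) → ℝ),
      Literature.Analysis.FluidPDE.IsClassicalNSSolutionOn (Set.Ico 0 T) ν 0 u p →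
      Literature.Analysis.FluidPDE.IsLerayHopfOn T ν 0 (u 0) u →
      Literature.Analysis.FluidPDE.HasRapidSpatialDecay (u 0) → ∀ (E₀ B₀ : ℝ), (∫ x, ‖u 0 x‖ ^ 2) ≤
      E₀ → (∀ x, ‖u 0 x‖ ≤ B₀) → ∀ t ∈ Set.Ico 0 T, ∀ x, ‖u t x‖ ≤ G E₀ B₀) → ∃ F : ℝ → ℝ → ℝ, ∀ (u
      : ℝ → EuclideanSpace ℝ (Fin 3) → EuclideanSpace ℝ (Fin 3)) (p : ℝ → EuclideanSpace ℝ (Fin 3)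
      → ℝ), Literature.Analysis.FluidPDE.IsClassicalNSSolutionOn (Set.Ico 0 T) ν 0 u p →
      Literature.Analysis.FluidPDE.IsLerayHopfOn T ν 0 (u 0) u →
      Literature.Analysis.FluidPDE.HasRapidSpatialDecay (u 0) → ∀ (E₀ B₀ : ℝ), (∫ x, ‖u 0 x‖ ^ 2) ≤
      E₀ → (∀ x, ‖u 0 x‖ ≤ B₀) → ∀ (M c t : ℝ), 2 * B₀ ≤ M → M / 2 ≤ c → c ≤ M → 0 < c → t ∈
      Set.Ico 0 T → -(∫ τ in Set.Ioo 0 t, ∫ x, max (1 - c / ‖u τ x‖) 0 * (fderiv ℝ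
      (Literature.Analysis.FluidPDE.normalisedPressure (u τ)) x (u τ x))) ≤ Real.sqrt (F E₀ B₀ *
      (∫⁻ τ in Set.Ioo 0 T, MeasureTheory.volume {x | c < ‖u τ x‖}).toReal) * Real.sqrt ((∫⁻ τ in
      Set.Ioo 0 T, ∫⁻ x, Set.indicator {x | c < ‖u τ x‖} (fun x => ENNReal.ofReal (‖fderiv ℝ (fun y
      => ‖u τ y‖) x‖ ^ 2)) x).toReal)) := by
  intro hH ν T hν hT G hG
  obtain ⟨m, -, F, hF⟩ := hH ν T hν hT
  -- the absorbed modulus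
  refine ⟨fun E₀ B₀ => max (F E₀ B₀) 0 *
      max (max ((2 * max (G E₀ B₀) 0 + 1) ^ m) ((2 * B₀) ^ m)) 0, ?_⟩
  intro u p hcl hLH hdec E₀ B₀ hE hB M c t hM hMc hcM hc ht
  -- the pressure work vanishes when the speed stays below `c` on `(0,t)`
  have hvanish : (∀ τ ∈ Set.Ioo 0 t, ∀ x, ‖u τ x‖ < c) →
      -(∫ τ in Set.Ioo 0 t, ∫ x, max (1 - c / ‖u τ x‖) 0 *
          (fderiv ℝ (normalisedPressure (u τ)) x (u τ x))) ≤
        Real.sqrt (max (F E₀ B₀) 0 * max (max ((2 * max (G E₀ B₀) 0 + 1) ^ m) ((2 * B₀) ^ m)) 0 *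
            (∫⁻ τ in Set.Ioo 0 T, volume {x | c < ‖u τ x‖}).toReal) *
          Real.sqrt ((∫⁻ τ in Set.Ioo 0 T, ∫⁻ x, Set.indicator {x | c < ‖u τ x‖}
            (fun x => ENNReal.ofReal (‖fderiv ℝ (fun y => ‖u τ y‖) x‖ ^ 2)) x).toReal) := by
    intro hlt
    have h0 := pressureWork_eq_zero_of_speed_lt hlt
    unfold pressureWork at h0
    rw [h0]
    exact rhs_nonneg _ _
  rcases le_or_gt B₀ 0 with hB0 | hB0
  · -- degenerate datum: `u ≡ 0` on `[0,T)`
    have hu0 : ∀ x, u 0 x = 0 := fun x => norm_le_zero_iff.1 ((hB x).trans hB0)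
    refine hvanish fun τ hτ x => ?_
    have hτ' : τ ∈ Set.Ico 0 T := ⟨hτ.1.le, hτ.2.trans ht.2⟩
    rw [levelSetModeration_eq_zero_of_datum_eq_zero hν hcl hLH hu0 hτ' x, norm_zero]
    exact hc
  · set Ms : ℝ := 2 * max (G E₀ B₀) 0 + 1 with hMs
    rcases le_or_gt M Ms with hle | hgt
    · -- nontrivial window: absorb `M ^ m`
      have hM0 : 0 < M := by linarith
      have key := hF u p hcl hLH hdec E₀ B₀ hE hB M c t hM hMc hcM hc ht
      refine key.trans (mul_le_mul_of_nonneg_right (Real.sqrt_le_sqrt ?_) (Real.sqrt_nonneg _))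
      have hV := ENNReal.toReal_nonneg (a := ∫⁻ τ in Set.Ioo 0 T, volume {x | c < ‖u τ x‖})
      refine mul_le_mul_of_nonneg_right ?_ hV
      have hpow : M ^ m ≤ max (max (Ms ^ m) ((2 * B₀) ^ m)) 0 := by
        rcases le_or_gt 0 m with hm0 | hm0
        · exact ((Real.rpow_le_rpow hM0.le hle hm0).trans (le_max_left _ _)).trans (le_max_left _ _)
        · have h2B : 0 < 2 * B₀ := by linarith
          exact ((Real.rpow_le_rpow_of_nonpos h2B hM hm0.le).trans (le_max_right _ _)).trans
            (le_max_left _ _)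
      calc F E₀ B₀ * M ^ m ≤ max (F E₀ B₀) 0 * M ^ m :=
            mul_le_mul_of_nonneg_right (le_max_left _ _) (Real.rpow_nonneg hM0.le _)
        _ ≤ max (F E₀ B₀) 0 * max (max (Ms ^ m) ((2 * B₀) ^ m)) 0 :=
            mul_le_mul_of_nonneg_left hpow (le_max_right _ _)
    · -- above `Ms`: the level `c` is never reached on `[0,T)`
      refine hvanish fun τ hτ x => ?_
      have hτ' : τ ∈ Set.Ico 0 T := ⟨hτ.1.le, hτ.2.trans ht.2⟩
      have h1 := hG u p hcl hLH hdec E₀ B₀ hE hB τ hτ' x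
      have h2 : G E₀ B₀ ≤ max (G E₀ B₀) 0 := le_max_left _ _
      linarith

/-- **`HighSpeedPressureWork ↔ LinearLevelSetLaw ∧ BoundedPairingBookkeeping`.** The crux of route
`LevelSetModeration` is EQUIVALENT to the conjunction of the two remaining registered stubs of line
`linear_closure` (both verbatim): the pressure-free linear level-set law L1 (`∃ m < 10/3, Λ(E₀,B₀)`:
`ν² D_c(T) ≤ Λ M^m V_c(T)` and `∫(|u(t)|−c)₊² ≤ 4Λ M^m V_c(T)/ν` on the windows `M ≥ 2B₀`) and the
bounded bookkeeping L3 (modulo a class-uniform speed bound the pairing is dominated with exponent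
`0`). `→`: `levelSetModeration_linearLevelSetLaw_of_highSpeedPressureWork` and
`levelSetModeration_boundedPairingBookkeeping_of_highSpeedPressureWork`; `←`: the landed transfer
`levelSetModeration_highSpeedPressureWork_of_linearLaw_of_bookkeeping`. -/
theorem levelSetModeration_highSpeedPressureWork_iff_linearLaw_and_bookkeeping :
    Summit.NavierStokesRegularity.NavierStokesRegularity.Theses.LevelSetModeration.HighSpeedPressureWork
      ↔ ((∀ (ν T : ℝ), 0 < ν → 0 < T → ∃ m : ℝ, m < 10 / 3 ∧ ∃ Λ : ℝ → ℝ → ℝ, ∀ (u : ℝ →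
      EuclideanSpace ℝ (Fin 3) → EuclideanSpace ℝ (Fin 3)) (p : ℝ → EuclideanSpace ℝ (Fin 3) → ℝ),
      Literature.Analysis.FluidPDE.IsClassicalNSSolutionOn (Set.Ico 0 T) ν 0 u p →
      Literature.Analysis.FluidPDE.IsLerayHopfOn T ν 0 (u 0) u →
      Literature.Analysis.FluidPDE.HasRapidSpatialDecay (u 0) → ∀ (E₀ B₀ : ℝ), (∫ x, ‖u 0 x‖ ^ 2) ≤
      E₀ → (∀ x, ‖u 0 x‖ ≤ B₀) → ∀ (M c : ℝ), 2 * B₀ ≤ M → M / 2 ≤ c → c ≤ M → 0 < c → ν ^ 2 * (∫⁻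
      τ in Set.Ioo 0 T, ∫⁻ x, Set.indicator {x | c < ‖u τ x‖} (fun x => ENNReal.ofReal (‖fderiv ℝ
      (fun y => ‖u τ y‖) x‖ ^ 2)) x).toReal ≤ Λ E₀ B₀ * M ^ m * (∫⁻ τ in Set.Ioo 0 T,
      MeasureTheory.volume {x | c < ‖u τ x‖}).toReal ∧ ∀ t ∈ Set.Ico 0 T, (∫ x, (max (‖u t x‖ - c)
      0) ^ 2) ≤ 4 * (Λ E₀ B₀ * M ^ m * (∫⁻ τ in Set.Ioo 0 T, MeasureTheory.volume {x | c < ‖u τ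
      x‖}).toReal) / ν) ∧ (∀ (ν T : ℝ), 0 < ν → 0 < T → ∀ G : ℝ → ℝ → ℝ, (∀ (u : ℝ →
      EuclideanSpace ℝ (Fin 3) → EuclideanSpace ℝ (Fin 3)) (p : ℝ → EuclideanSpace ℝ (Fin 3) → ℝ),
      Literature.Analysis.FluidPDE.IsClassicalNSSolutionOn (Set.Ico 0 T) ν 0 u p →
      Literature.Analysis.FluidPDE.IsLerayHopfOn T ν 0 (u 0) u →
      Literature.Analysis.FluidPDE.HasRapidSpatialDecay (u 0) → ∀ (E₀ B₀ : ℝ), (∫ x, ‖u 0 x‖ ^ 2) ≤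
      E₀ → (∀ x, ‖u 0 x‖ ≤ B₀) → ∀ t ∈ Set.Ico 0 T, ∀ x, ‖u t x‖ ≤ G E₀ B₀) → ∃ F : ℝ → ℝ → ℝ, ∀ (u
      : ℝ → EuclideanSpace ℝ (Fin 3) → EuclideanSpace ℝ (Fin 3)) (p : ℝ → EuclideanSpace ℝ (Fin 3)
      → ℝ), Literature.Analysis.FluidPDE.IsClassicalNSSolutionOn (Set.Ico 0 T) ν 0 u p →
      Literature.Analysis.FluidPDE.IsLerayHopfOn T ν 0 (u 0) u →
      Literature.Analysis.FluidPDE.HasRapidSpatialDecay (u 0) → ∀ (E₀ B₀ : ℝ), (∫ x, ‖u 0 x‖ ^ 2) ≤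
      E₀ → (∀ x, ‖u 0 x‖ ≤ B₀) → ∀ (M c t : ℝ), 2 * B₀ ≤ M → M / 2 ≤ c → c ≤ M → 0 < c → t ∈
      Set.Ico 0 T → -(∫ τ in Set.Ioo 0 t, ∫ x, max (1 - c / ‖u τ x‖) 0 * (fderiv ℝ
      (Literature.Analysis.FluidPDE.normalisedPressure (u τ)) x (u τ x))) ≤ Real.sqrt (F E₀ B₀ *
      (∫⁻ τ in Set.Ioo 0 T, MeasureTheory.volume {x | c < ‖u τ x‖}).toReal) * Real.sqrt ((∫⁻ τ in
      Set.Ioo 0 T, ∫⁻ x, Set.indicator {x | c < ‖u τ x‖} (fun x => ENNReal.ofReal (‖fderiv ℝ (fun y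
      => ‖u τ y‖) x‖ ^ 2)) x).toReal))) :=
  ⟨fun hH => ⟨levelSetModeration_linearLevelSetLaw_of_highSpeedPressureWork hH,
      levelSetModeration_boundedPairingBookkeeping_of_highSpeedPressureWork hH⟩,
    fun h => levelSetModeration_highSpeedPressureWork_of_linearLaw_of_bookkeeping h.1 h.2⟩

/-- **The crux implies uniform quantitative regularity of the data class.** On every fibre
`(ν, T)`, `HighSpeedPressureWork` yields a class-uniform a priori speed bound
`‖u(t,x)‖ ≤ G(E₀,B₀)` on `[0,T) × ℝ³` for every classical Leray–Hopf solution from a rapidly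
decaying datum with `∫|u₀|² ≤ E₀`, `|u₀| ≤ B₀` (crux → L1 → class-uniform De Giorgi closure).
This is the disprover's `APrioriSpeedBound` (Negative/ExponentCollapse §1): the item is
regularity-strength, uniformly in the data class. -/
theorem levelSetModeration_aprioriSpeedBound_of_highSpeedPressureWork :
    Summit.NavierStokesRegularity.NavierStokesRegularity.Theses.LevelSetModeration.HighSpeedPressureWork
      → ∀ (ν T : ℝ), 0 < ν → 0 < T → ∃ G : ℝ → ℝ → ℝ,
        Summit.NavierStokesRegularity.NavierStokesRegularity.Theorems.HighSpeedPressureWork.Negative.APrioriSpeedBound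
          ν T G := by
  intro hH ν T hν hT
  obtain ⟨m, hm, Λ, hΛ⟩ := levelSetModeration_linearLevelSetLaw_of_highSpeedPressureWork hH ν T hν hT
  exact levelSetModeration_aprioriSpeedBound_of_linearLevelSetLaw ν T m Λ hν hT hm hΛ

end Summit.NavierStokesRegularity.NavierStokesRegularity.Theorems

end
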